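import Summits.QuantumFields.BalabanUV.Beta.D1BFx.SplitInstanceS
import Summits.QuantumFields.BalabanUV.Beta.D1BFx.AssemblyEndRecut

/-!
# `BalabanUV.Beta.D1BFx.AssemblyEndRecutS` — road «BF-x» for binder row D1, A7 END OVER THE TWO-PROFILE RE-CUT REST TABLE, variant «ENDₛ»
# (END-ii-SPEC v1.1 §3 (b), chain link 1 of the END-level twins): `AssemblyEndRecut.defect_le_at_recut` with the loop-weight tie RESCALED
# (`hωs : ω_gh·(s·cK)² = −2·(ω_gl·cE²)`) and the REST words read from `SplitInstanceS.restKS (gp b) (s•gp b)` — the ghost tadpole and ghost bubble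
# words at the rescaled frozen profile; (CONV) for every such word PROVED here; `s = 1` is the END of record

HONEST DEPENDENCY (page 1, mandatory): continuum YM on T⁴ ⇐ BetaPertH ∧ nine spine estimates (0/9 proved); BetaPertH ⇐ (D1) ∧ (D4) ∧
CAP+tail; G-an2-4 gates asym, D1 and NE2/3/4.  HONEST FRAMING (cell contract, verbatim): «discharging `BetaPertH` makes Bałaban's UV
stability UNCONDITIONAL — a real constructive-QFT result; it is NOT the continuum limit and NOT the Clay problem.»  THIS MODULE DISCHARGES
NOTHING of the wall: [folklore] composition BY NAME of the owner's generic assembly `Assembly.abs_defect_le_of_slots` with the landed slot instances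
((F) `hF_SbfBal_of_divFree` ∕ `hF_PghQ_of_wardRows`, (CONV) `conv_SbfBal` ∕ `conv_PghQ` ∕ `AssemblyEndRecut.conv_recut`, (SPLIT) `SplitInstanceS.split_at_basePoint_recutS`);
what REMAINS displayed, by name — (K) `hK` + `hωs` + `hlam`; the leg binder `Spr (Ga n a)`; the five slot-table sockets; `hdiv`; `hrowgh`; the frozen profile's
bound and evenness; the per-word bounds (REST′) for the TWO-PROFILE words `restKS (gp b) (s•gp b)`; (U).  No `def`, no `Prop` minted, nothing cited, 0 sorry.
0 wall binders discharged; NOT the (REST) bounds, NOT (K), NOT D1, NOT `BetaPertH`, NOT continuum, NOT Clay.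

ABSOLUTE RULE (cell charter, verbatim): «No internally-minted statement may enter as a cited fact. Every hypothesis is either kernel-proved in
this package or a verbatim quotation of a PUBLISHED theorem with page reference. The manuscript(s) under audit are NOT citable for their own
disputed steps — they are the thing under adjudication; programme-internal (2001/route/tribunal) claims are never citable.»

WHY (owner ruling ρ-g11-9 «GHOST UNITS»; `HOME/b2b-balaban-beta-d1-p2/END-ii-SPEC.md` v1.1 §§1–3; binder GO R-D1-g31-2).  The END of record's tie `hω` is short of
R-4(v) by `n⁴` against the typed ghost leg; the consistent reading keeps every gluon-side object and the MAIN value and reads the ghost graded words at the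
regraded profile `n⁻²·gfrz`.  `SplitInstanceS` typed both changes once for a scalar `s`; THIS FILE lifts them to the road's defect bound at one block size —
the statement of `AssemblyEndRecut.defect_le_at_recut` with exactly two edits: `hω ↦ (s) (hωs)`, and `restK' n a (gp b)` ↦ `restKS n a (gp b) (fun v => s * gp b v)`
in the (REST′) hypothesis.  The END-level files above (`RoadEndBFxRecutS`, …) twin the chain of record over this theorem with `s : ℕ → ℝ` displayed and pinned
`s n = n⁻²` at the very end (END-ii); `s ≡ 1` is the chain of record.

CONTENT.
* §1 [folklore] **`conv_recutS`** — (CONV) for every two-profile word at fixed `(n, b)`: the gluon ranges ARE `restK'`'s words at `g` (rfl), the ghost ranges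
  ARE `restK'`'s words at `s•g` (rfl), which is exponentially bounded with constant `|s|·C`; both by `AssemblyEndRecut.conv_recut`.  **`hKr_recutS`** (all words,
  every base site, site-dependent profile).
* §2 [folklore] **`defect_le_at_recutS`** — `|c − Σ_{b ∈ image resSite} n⁻⁴·fullSum (stK μ ν N (gp b))| ≤ Σ_u CU u + Σ_τ CR τ` from (K) with `hωs`∕`hlam`, the leg
  binder, the sockets, `hdiv`, `hrowgh`, the profile's bound and evenness, (REST′) for `restKS (gp b) (s•gp b)`, (U).
Unit `b2b-balaban-beta-d1-p2` (road owner, gen 12); `LEAVES-BFx.md` row A7-ENDₛ (chain link 1); END-ii-SPEC v1.1 §3 (b).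
-/

noncomputable section

open Finset Filter Topology
open scoped BigOperators
open Literature.MathematicalPhysics.QuantumFieldTheory.Balaban1983to89
open Literature.MathematicalPhysics.QuantumFieldTheory.Balaban1983to89.Beta
open WindowIdentification (fullSum psum)
open B12Sec2to5 (l1)
open DyadicShell (Pt toReal)
open ExpKernelCalculus (Site MKer BiLoc shiftK)
open SquareTable (stK)
open DressedMomentNormalisation (resSite)
open Summit.QuantumFields.BalabanUV.Beta.TameKernelCalculus (Spr Loc)
open Summit.QuantumFields.BalabanUV.Beta.D1BFx.MomentTransferPeriodic (baseKer)
open Summit.QuantumFields.BalabanUV.Beta.D1BFx.GluonLeg (Ga)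
open Summit.QuantumFields.BalabanUV.Beta.D1BFx.ReducedKernel (TableR TOfRed)
open Summit.QuantumFields.BalabanUV.Beta.D1BFx.DressedTadpoleTable (tableRed)
open Summit.QuantumFields.BalabanUV.Beta.D1BFx.ReducedKernelSandwich (fineHess)
open Summit.QuantumFields.BalabanUV.Beta.D1BFx.FineStencilBFBalaban (SbfBal)
open Summit.QuantumFields.BalabanUV.Beta.D1BFx.SecondStencilBF (Wbf)
open Summit.QuantumFields.BalabanUV.Beta.D1BFx.GhostKernelComplete (PghQ fineHessGhQ)
open Summit.QuantumFields.BalabanUV.Beta.D1BFx.SplitInstance (RestIdx)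
open Summit.QuantumFields.BalabanUV.Beta.D1BFx.Assembly (abs_defect_le_of_slots)
open Summit.QuantumFields.BalabanUV.Beta.D1BFx.AssemblySlots (conv_PghQ hF_PghQ_of_wardRows)
open Summit.QuantumFields.BalabanUV.Beta.D1BFx.AssemblySlotsBal (conv_SbfBal)
open Summit.QuantumFields.BalabanUV.Beta.D1BFx.FineHessianWardKroneckerBlock (hF_SbfBal_of_divFree)
open Summit.QuantumFields.BalabanUV.Beta.D1BFx.SplitRecut (restK')
open Summit.QuantumFields.BalabanUV.Beta.D1BFx.SplitInstanceS (restKS restKS_tad_eq restKS_bub_eq restKS_gtad_eq restKS_gbub_eq split_at_basePoint_recutS)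
open Summit.QuantumFields.BalabanUV.Beta.D1BFx.AssemblyEndRecut (conv_recut)

namespace Summit.QuantumFields.BalabanUV.Beta.D1BFx.AssemblyEndRecutS

/-! ## §1 (CONV) for every two-profile re-cut REST word -/

section Conv

variable (n : ℕ) [NeZero n] (a : ℝ) {g : Pt → ℝ} (cE cΛ cR cK cQ cE₂ cJ4 cΛ₂ cR₂ cQ₂ x₀ : ℝ) {WE WJ WΛ WR WQ : TableR}
  (ωgl ωgh lam N : ℝ) {μ ν : Fin 4} (b : Pt) {C δ CE CJ CΛt CRt CQ δW : ℝ}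

/-- [folklore] **(CONV) FOR EVERY TWO-PROFILE RE-CUT REST WORD AT FIXED `(n, b)`** (`0 < a`, `Spr (Ga n a)`, exponentially bounded profile `g`, the five slot
tables bi-localised at one rate `δW > 0`, `μ ≠ ν`, any scalar `s`): on the gluon ranges and the corner ∕ cross words the word IS `restK'`'s at `g`, on the ghost
ranges it IS `restK'`'s at `s•g` (exponentially bounded with constant `|s|·C`) — `AssemblyEndRecut.conv_recut` in both cases. -/
theorem conv_recutS (ha : 0 < a) (hGa : Spr (Ga n a)) (hδ : 0 < δ) (hg : ∀ v, |g v| ≤ C * Real.exp (-δ * l1 v)) (hδW : 0 < δW)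
    (hE : ∀ κ u l u', BiLoc (WE κ u l u') u u' CE δW) (hJ : ∀ κ u l u', BiLoc (WJ κ u l u') u u' CJ δW)
    (hΛ : ∀ κ u l u', BiLoc (WΛ κ u l u') u u' CΛt δW) (hR : ∀ κ u l u', BiLoc (WR κ u l u') u u' CRt δW)
    (hQ : ∀ κ u l u', BiLoc (WQ κ u l u') u u' CQ δW) (hμν : μ ≠ ν) (s : ℝ) (τ : RestIdx) :
    ∃ B, Tendsto (psum (restKS n a g (fun v => s * g v) cE cΛ cR cK cQ cE₂ cJ4 cΛ₂ cR₂ cQ₂ x₀ WE WJ WΛ WR WQ ωgl ωgh lam N μ ν b τ)) atTop (𝓝 B) := by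
  -- the rescaled profile is exponentially bounded
  have hg' : ∀ v, |s * g v| ≤ |s| * C * Real.exp (-δ * l1 v) := fun v => by
    rw [abs_mul, mul_assoc]
    exact mul_le_mul_of_nonneg_left (hg v) (abs_nonneg s)
  rcases τ with x | x | r | x | k
  · rw [restKS_tad_eq]
    exact conv_recut n a cE cΛ cR cK cQ cE₂ cJ4 cΛ₂ cR₂ cQ₂ x₀ ωgl ωgh lam N b ha hGa hδ hg hδW hE hJ hΛ hR hQ hμν _
  · rw [restKS_bub_eq]
    exact conv_recut n a cE cΛ cR cK cQ cE₂ cJ4 cΛ₂ cR₂ cQ₂ x₀ ωgl ωgh lam N b ha hGa hδ hg hδW hE hJ hΛ hR hQ hμν _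
  · rw [restKS_gtad_eq]
    exact conv_recut n a cE cΛ cR cK cQ cE₂ cJ4 cΛ₂ cR₂ cQ₂ x₀ ωgl ωgh lam N b ha hGa hδ hg' hδW hE hJ hΛ hR hQ hμν _
  · rw [restKS_gbub_eq]
    exact conv_recut n a cE cΛ cR cK cQ cE₂ cJ4 cΛ₂ cR₂ cQ₂ x₀ ωgl ωgh lam N b ha hGa hδ hg' hδW hE hJ hΛ hR hQ hμν _
  · rw [show restKS n a g (fun v => s * g v) cE cΛ cR cK cQ cE₂ cJ4 cΛ₂ cR₂ cQ₂ x₀ WE WJ WΛ WR WQ ωgl ωgh lam N μ ν b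
        (Sum.inr (Sum.inr (Sum.inr (Sum.inr k)))) =
      restK' n a g cE cΛ cR cK cQ cE₂ cJ4 cΛ₂ cR₂ cQ₂ x₀ WE WJ WΛ WR WQ ωgl ωgh lam N μ ν b (Sum.inr (Sum.inr (Sum.inr (Sum.inr k)))) from rfl]
    exact conv_recut n a cE cΛ cR cK cQ cE₂ cJ4 cΛ₂ cR₂ cQ₂ x₀ ωgl ωgh lam N b ha hGa hδ hg hδW hE hJ hΛ hR hQ hμν _

/-- [folklore] **THE `hKr` HYPOTHESIS OF THE ASSEMBLY FOR THE TWO-PROFILE RE-CUT TABLE, ALL WORDS, EVERY BASE SITE** (site-dependent profile `gp b`,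
ghost words at `s•gp b`), from the END's own hypotheses. -/
theorem hKr_recutS {gp : Pt → Pt → ℝ} (ha : 0 < a) (hGa : Spr (Ga n a))
    (hg : ∀ b : Pt, ∃ C δ : ℝ, 0 < δ ∧ ∀ v, |gp b v| ≤ C * Real.exp (-δ * l1 v)) (hδW : 0 < δW)
    (hE : ∀ κ u l u', BiLoc (WE κ u l u') u u' CE δW) (hJ : ∀ κ u l u', BiLoc (WJ κ u l u') u u' CJ δW)
    (hΛ : ∀ κ u l u', BiLoc (WΛ κ u l u') u u' CΛt δW) (hR : ∀ κ u l u', BiLoc (WR κ u l u') u u' CRt δW)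
    (hQ : ∀ κ u l u', BiLoc (WQ κ u l u') u u' CQ δW) (hμν : μ ≠ ν) (s : ℝ) :
    ∀ τ : RestIdx, ∀ b ∈ (univ : Finset (Fin 4 → Fin n)).image resSite, ∃ B, Tendsto (psum (fun w : Pt =>
      restKS n a (gp b) (fun v => s * gp b v) cE cΛ cR cK cQ cE₂ cJ4 cΛ₂ cR₂ cQ₂ x₀ WE WJ WΛ WR WQ ωgl ωgh lam N μ ν b τ w)) atTop (𝓝 B) := by
  intro τ b _
  obtain ⟨C, δ, hδ, hgb⟩ := hg b
  exact conv_recutS n a cE cΛ cR cK cQ cE₂ cJ4 cΛ₂ cR₂ cQ₂ x₀ ωgl ωgh lam N b ha hGa hδ hgb hδW hE hJ hΛ hR hQ hμν s τ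

end Conv

/-! ## §2 The road's defect bound at one block size over the two-profile re-cut table -/

section At

variable (n : ℕ) [NeZero n] (a cE cVH cΛ cR cK cQ cE₂ cJ4 cΛ₂ cR₂ cQ₂ x₀ ωgl ωgh lam N : ℝ) {WE WJ WΛ WR WQ : TableR}
  {CE CJ CΛ CRt CQ δW : ℝ} {gp : Pt → Pt → ℝ} {μ ν : Fin 4} {υ : Type*} [Fintype υ] {c : ℝ} {Ru CU : υ → ℝ} {CR : RestIdx → ℝ}

/-- [folklore] **ROAD BF-x AT BLOCK SIZE `n` (`2 ≤ n`, `Odd n`) OVER THE TWO-PROFILE RE-CUT REST TABLE, variant «ENDₛ»: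
`|c − Σ_{b ∈ image resSite} n⁻⁴·fullSum (stK μ ν N (gp b))| ≤ Σ_u CU u + Σ_τ CR τ`** from (K) the kernel representation of `c` through the two fine-loop
pieces of record with the RESCALED loop-weight tie `hωs : ω_gh·(s·cK)² = −2·(ω_gl·cE²)` and the normalisation `hlam`, the leg binder, the slot-table sockets, the
first-bond divergence-freeness `hdiv`, the ghost Ward rows, the frozen profile's bound and evenness, the per-word bounds (REST′) for the TWO-PROFILE words
`restKS (gp b) (s•gp b)` (ghost tadpole ∕ ghost bubble words at the rescaled profile), and (U) — slots (F), (CONV) (both fine pieces AND every rest word) and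
(SPLIT) being DISCHARGED by landed instances.  `AssemblyEndRecut.defect_le_at_recut` is the case `s = 1` (`SplitInstanceS.restKS_self`). -/
theorem defect_le_at_recutS (hn : 2 ≤ n) (hodd : Odd n) (ha : 0 < a) (hμν : μ ≠ ν) (hGa : Spr (Ga n a))
    (hK : c = ωgl * B12Beta.secondMoment (TOfRed n a (SbfBal n a cE cVH cΛ cR cK cQ)
        (tableRed n (Wbf cE₂ cJ4 cΛ₂ cR₂ cQ₂ WE WJ WΛ WR WQ))) μ ν
      + ωgh * B12Beta.secondMoment (PghQ n a x₀ cK cQ) μ ν + ∑ u, Ru u)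
    (s : ℝ) (hωs : ωgh * (s * cK) ^ 2 = -2 * (ωgl * cE ^ 2)) (hlam : ωgl * cE ^ 2 = 2 * N ^ 2 * lam)
    (hδW : 0 < δW)
    (hE : ∀ κ u l u', BiLoc (WE κ u l u') u u' CE δW) (hJ : ∀ κ u l u', BiLoc (WJ κ u l u') u u' CJ δW)
    (hΛ : ∀ κ u l u', BiLoc (WΛ κ u l u') u u' CΛ δW) (hR : ∀ κ u l u', BiLoc (WR κ u l u') u u' CRt δW)
    (hQ : ∀ κ u l u', BiLoc (WQ κ u l u') u u' CQ δW)
    (hEc : ∀ (κ : Fin 4) (u : Site 4) (l : Fin 4) (u' t : Site 4), WE κ (u + (n : ℤ) • t) l (u' + (n : ℤ) • t) = shiftK (-((n : ℤ) • t)) (WE κ u l u'))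
    (hJc : ∀ (κ : Fin 4) (u : Site 4) (l : Fin 4) (u' t : Site 4), WJ κ (u + (n : ℤ) • t) l (u' + (n : ℤ) • t) = shiftK (-((n : ℤ) • t)) (WJ κ u l u'))
    (hΛc : ∀ (κ : Fin 4) (u : Site 4) (l : Fin 4) (u' t : Site 4), WΛ κ (u + (n : ℤ) • t) l (u' + (n : ℤ) • t) = shiftK (-((n : ℤ) • t)) (WΛ κ u l u'))
    (hRc : ∀ (κ : Fin 4) (u : Site 4) (l : Fin 4) (u' t : Site 4), WR κ (u + (n : ℤ) • t) l (u' + (n : ℤ) • t) = shiftK (-((n : ℤ) • t)) (WR κ u l u'))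
    (hQc : ∀ (κ : Fin 4) (u : Site 4) (l : Fin 4) (u' t : Site 4), WQ κ (u + (n : ℤ) • t) l (u' + (n : ℤ) • t) = shiftK (-((n : ℤ) • t)) (WQ κ u l u'))
    (hEs : ∀ κ u l u', WE κ u l u' = WE l u' κ u) (hJs : ∀ κ u l u', WJ κ u l u' = WJ l u' κ u) (hΛs : ∀ κ u l u', WΛ κ u l u' = WΛ l u' κ u)
    (hRs : ∀ κ u l u', WR κ u l u' = WR l u' κ u) (hQs : ∀ κ u l u', WQ κ u l u' = WQ l u' κ u)
    (hdiv : ∀ (l' : Fin 4) (u' u : Site 4), ∑ κ' : Fin 4,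
      (fineHess n a (SbfBal n a cE cVH cΛ cR cK cQ) (Wbf cE₂ cJ4 cΛ₂ cR₂ cQ₂ WE WJ WΛ WR WQ) κ' l' (u - Pi.single κ' 1) u'
        - fineHess n a (SbfBal n a cE cVH cΛ cR cK cQ) (Wbf cE₂ cJ4 cΛ₂ cR₂ cQ₂ WE WJ WΛ WR WQ) κ' l' u u') = 0)
    (hrowgh : ∀ (κ' l' : Fin 4) (b : Site 4), HasSum (fineHessGhQ n a x₀ cK cQ κ' l' b) 0)
    (hg : ∀ b : Pt, ∃ C δ : ℝ, 0 < δ ∧ ∀ v, |gp b v| ≤ C * Real.exp (-δ * l1 v)) (hgev : ∀ b w : Pt, gp b (-w) = gp b w)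
    (hRest : ∀ τ : RestIdx, |∑ b ∈ (univ : Finset (Fin 4 → Fin n)).image resSite, ((n : ℝ) ^ 4)⁻¹ * fullSum (fun w : Pt =>
      restKS n a (gp b) (fun v => s * gp b v) cE cΛ cR cK cQ cE₂ cJ4 cΛ₂ cR₂ cQ₂ x₀ WE WJ WΛ WR WQ ωgl ωgh lam N μ ν b τ w)| ≤ CR τ)
    (hU : ∀ u, |Ru u| ≤ CU u) :
    |c - ∑ b ∈ (univ : Finset (Fin 4 → Fin n)).image resSite, ((n : ℝ) ^ 4)⁻¹ * fullSum (stK μ ν N (gp b))|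
      ≤ (∑ u, CU u) + ∑ τ, CR τ := by
  have h1 : 1 ≤ n := le_trans one_le_two hn
  have hEl : ∀ κ u l u', Loc (WE κ u l u') := fun κ u l u' => ⟨u, u', CE, δW, hδW, hE κ u l u'⟩
  have hJl : ∀ κ u l u', Loc (WJ κ u l u') := fun κ u l u' => ⟨u, u', CJ, δW, hδW, hJ κ u l u'⟩
  have hΛl : ∀ κ u l u', Loc (WΛ κ u l u') := fun κ u l u' => ⟨u, u', CΛ, δW, hδW, hΛ κ u l u'⟩
  have hRl : ∀ κ u l u', Loc (WR κ u l u') := fun κ u l u' => ⟨u, u', CRt, δW, hδW, hR κ u l u'⟩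
  have hQl : ∀ κ u l u', Loc (WQ κ u l u') := fun κ u l u' => ⟨u, u', CQ, δW, hδW, hQ κ u l u'⟩
  refine abs_defect_le_of_slots (ι := Fin 2) (T := RestIdx) (υ := υ) (μ := μ) (ν := ν) (N := N) (CU := CU) (CR := CR)
    (c := fun _ => c) (Bset := fun _ => (univ : Finset (Fin 4 → Fin n)).image resSite) (wt := fun _ _ => ((n : ℝ) ^ 4)⁻¹)
    (Gf := fun _ => gp)
    (P := fun i _ => if i = 0 then TOfRed n a (SbfBal n a cE cVH cΛ cR cK cQ) (tableRed n (Wbf cE₂ cJ4 cΛ₂ cR₂ cQ₂ WE WJ WΛ WR WQ))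
      else PghQ n a x₀ cK cQ)
    (ω := fun i _ => if i = 0 then ωgl else ωgh) (R := fun u _ => Ru u)
    (Kf := fun i _ b w => if i = 0 then ((n : ℝ) ^ 8)⁻¹ * (toReal w μ * toReal w ν *
        baseKer (fineHess n a (SbfBal n a cE cVH cΛ cR cK cQ) (Wbf cE₂ cJ4 cΛ₂ cR₂ cQ₂ WE WJ WΛ WR WQ) μ ν) b w)
      else ((n : ℝ) ^ 8)⁻¹ * (toReal w μ * toReal w ν * baseKer (fineHessGhQ n a x₀ cK cQ μ ν) b w))
    (Kr := fun τ _ b w => restKS n a (gp b) (fun v => s * gp b v) cE cΛ cR cK cQ cE₂ cJ4 cΛ₂ cR₂ cQ₂ x₀ WE WJ WΛ WR WQ ωgl ωgh lam N μ ν b τ w)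
    ?_ ?_ ?_ ?_ ?_ ?_ ?_ n hn
  · -- (K)
    intro _ _
    rw [Fin.sum_univ_two]
    simp only [Fin.isValue, if_true, one_ne_zero, if_false]
    exact hK
  · -- (F)
    intro i _ _
    fin_cases i
    · simp only [Fin.zero_eta, Fin.isValue, if_true]
      exact hF_SbfBal_of_divFree n a cE cVH cΛ cR cK cQ cE₂ cJ4 cΛ₂ cR₂ cQ₂ h1 ha hGa hδW hE hJ hΛ hR hQ hEc hJc hΛc hRc hQc hEs hJs hΛs
        hRs hQs hdiv μ ν
    · simp only [Fin.mk_one, Fin.isValue, one_ne_zero, if_false]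
      exact hF_PghQ_of_wardRows n a x₀ cK cQ ha hodd hrowgh μ ν
  · -- (CONV) fine pieces
    intro i _ _
    fin_cases i
    · simp only [Fin.zero_eta, Fin.isValue, if_true]
      exact conv_SbfBal n a cE cVH cΛ cR cK cQ cE₂ cJ4 cΛ₂ cR₂ cQ₂ ha hGa hδW hE hJ hΛ hR hQ μ ν
    · simp only [Fin.mk_one, Fin.isValue, one_ne_zero, if_false]
      exact conv_PghQ n a x₀ cK cQ ha μ ν
  · -- (CONV) rest words — PROVED for the two-profile re-cut table
    intro τ _ _ b hb
    exact hKr_recutS n a cE cΛ cR cK cQ cE₂ cJ4 cΛ₂ cR₂ cQ₂ x₀ ωgl ωgh lam N ha hGa hg hδW hE hJ hΛ hR hQ hμν s τ b hb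
  · -- (SPLIT) for the two-profile re-cut table, rescaled tie
    intro _ _ b _ w
    rw [Fin.sum_univ_two]
    simp only [Fin.isValue, if_true, one_ne_zero, if_false]
    obtain ⟨C, δ, hδ, hgb⟩ := hg b
    exact split_at_basePoint_recutS n a cE cVH cΛ cR cK cQ cE₂ cJ4 cΛ₂ cR₂ cQ₂ x₀ WE WJ WΛ WR WQ ha hGa hδ hgb (hgev b) hEl hJl hΛl hRl hQl hμν
      s hωs hlam b w
  · -- (U)
    intro u _ _
    exact hU u
  · -- (REST′)
    intro τ _ _
    exact hRest τ

end At

end Summit.QuantumFields.BalabanUV.Beta.D1BFx.AssemblyEndRecutS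

end
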